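import Literature.NumberTheory.LFunctions.PatelYangBlockSums
import HarnessLib

/-!
# Patel–Yang's Lemma 3.4 with the shift parameter `q = ⌊θ₁a^{36/41}t^{-11/41}⌋ + 1`

Topic `Literature/NumberTheory/LFunctions`. Patel–Yang 2024, end of the proof of Lemma 3.4: in the
top-range block bound `Literature.NumberTheory.LFunctions.VdC.topBlock_cpow_le` (free `q`) one
takes `q ≍ θ₁a^{36/41}t^{-11/41}` and, for `a ≥ θ₂t^{7/17}`, `t ≥ t₀`, bounds every term by a
monomial in `a` and `t` (the exponent pair `ABA³B(0,1) = (11/82, 57/82)`):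
`‖∑_{a<n≤b} n^{-1/2-it}‖ ≤ α(√X₁ a^{5/82}t^{11/82} + √X₂ a^{-17/328}t^{61/328} + √X₀ a^{87/164}t^{-15/82}
  + √(2e₀) + √X₄ a^{-23/123}t^{5/41} + √X₅ a^{-1/41}t^{6/41})`,
with `α = √(h - 1 + θ₁θ₂^{-5/41}t₀^{-222/697})` and explicit `X_i` (our constants; we take
`q = ⌊Q⌋ + 1 ≥ Q`, which removes Patel–Yang's factor `1/(1 - q₀⁻¹)` and makes `q ≥ 1` automatic,
at the price of `q ≤ (1 + q₀⁻¹)Q`, `q₀ = θ₁θ₂^{36/41}t₀^{65/697}`). Everything is PROVED.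

## References

* D. Patel, A. Yang, *An explicit sub-Weyl bound for `ζ(1/2 + it)`*, J. Number Theory 262 (2024),
  proof of Lemma 3.4 (the choice of `q` and the final inequalities). [cite: PatelYang2024, Lemma 3.4]
-/

noncomputable section

open Real Set

namespace Literature.NumberTheory.LFunctions
namespace VdC

/-! ### Elementary `rpow` bookkeeping -/

/-- `(θ a^x t^y)^s = θ^s a^{xs} t^{ys}`. [folklore] -/
theorem triple_rpow {θ a t x y s : ℝ} (hθ : 0 ≤ θ) (ha : 0 < a) (ht : 0 < t) :
    (θ * a ^ x * t ^ y) ^ s = θ ^ s * a ^ (x * s) * t ^ (y * s) := by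
  rw [Real.mul_rpow (by positivity) (Real.rpow_nonneg ht.le _),
    Real.mul_rpow hθ (Real.rpow_nonneg ha.le _), Real.rpow_mul ha.le, Real.rpow_mul ht.le]

/-- `a^{x₁}t^{y₁} · a^{x₂}t^{y₂} = a^{x}t^{y}` when the exponents add up. [folklore] -/
theorem monomial_mul {a t x₁ y₁ x₂ y₂ x y : ℝ} (ha : 0 < a) (ht : 0 < t) (hx : x₁ + x₂ = x)
    (hy : y₁ + y₂ = y) : a ^ x₁ * t ^ y₁ * (a ^ x₂ * t ^ y₂) = a ^ x * t ^ y := by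
  rw [← hx, ← hy, Real.rpow_add ha, Real.rpow_add ht]; ring

/-- `√(κ a^x t^y) = √κ a^{x/2} t^{y/2}`. [folklore] -/
theorem sqrt_monomial {κ a t x y : ℝ} (hκ : 0 ≤ κ) (ha : 0 < a) (ht : 0 < t) :
    Real.sqrt (κ * a ^ x * t ^ y) = Real.sqrt κ * a ^ (x / 2) * t ^ (y / 2) := by
  rw [Real.sqrt_eq_rpow, Real.sqrt_eq_rpow, triple_rpow hκ ha ht]
  congr 2 <;> ring

/-- `√(x₁ + ⋯) ≤ √x₁ + ⋯`: the two-term case. [folklore] -/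
theorem sqrt_add_le' {x y : ℝ} (hx : 0 ≤ x) (hy : 0 ≤ y) :
    Real.sqrt (x + y) ≤ Real.sqrt x + Real.sqrt y := by
  rw [Real.sqrt_le_left (by positivity)]
  have h1 := Real.sq_sqrt hx
  have h2 := Real.sq_sqrt hy
  nlinarith [Real.sqrt_nonneg x, Real.sqrt_nonneg y]

/-! ### The shift parameter -/

/-- `Q = θ₁ a^{36/41} t^{-11/41}`. [cite: PatelYang2024, Lemma 3.4] -/
def pyQ (θ₁ a t : ℝ) : ℝ := θ₁ * a ^ (36 / 41 : ℝ) * t ^ (-(11 / 41 : ℝ))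

/-- `q = ⌊Q⌋ + 1` (so that `Q ≤ q ≤ Q + 1` and `q ≥ 1`). [cite: PatelYang2024, Lemma 3.4] -/
def pyq (θ₁ a t : ℝ) : ℕ := ⌊pyQ θ₁ a t⌋₊ + 1

/-- `1 ≤ q`. [folklore] -/
theorem one_le_pyq (θ₁ a t : ℝ) : 1 ≤ pyq θ₁ a t := Nat.le_add_left 1 _

/-- `Q ≤ q`. [folklore] -/
theorem pyQ_le_pyq (θ₁ a t : ℝ) : pyQ θ₁ a t ≤ pyq θ₁ a t := by
  unfold pyq; push_cast; exact (Nat.lt_floor_add_one _).le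

/-- `q ≤ Q + 1` (`Q ≥ 0`). [folklore] -/
theorem pyq_le (θ₁ a t : ℝ) (hQ : 0 ≤ pyQ θ₁ a t) : (pyq θ₁ a t : ℝ) ≤ pyQ θ₁ a t + 1 := by
  unfold pyq; push_cast; linarith [Nat.floor_le hQ]

/-- **The lower bound `Q ≥ q₀`**: for `a ≥ θ₂t^{7/17}` and `t ≥ t₀ > 0`,
`Q ≥ θ₁θ₂^{36/41}t₀^{65/697}`. [cite: PatelYang2024, Lemma 3.4] -/
theorem pyQ_ge {θ₁ θ₂ a t t₀ : ℝ} (hθ₁ : 0 < θ₁) (hθ₂ : 0 < θ₂) (ht₀ : 0 < t₀) (ht : t₀ ≤ t)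
    (ha : θ₂ * t ^ (7 / 17 : ℝ) ≤ a) :
    θ₁ * θ₂ ^ (36 / 41 : ℝ) * t₀ ^ (65 / 697 : ℝ) ≤ pyQ θ₁ a t := by
  have ht0 : 0 < t := ht₀.trans_le ht
  have ha0 : 0 < a := lt_of_lt_of_le (by positivity) ha
  unfold pyQ
  have h1 : (θ₂ * t ^ (7 / 17 : ℝ)) ^ (36 / 41 : ℝ) ≤ a ^ (36 / 41 : ℝ) :=
    Real.rpow_le_rpow (by positivity) ha (by norm_num)
  rw [Real.mul_rpow hθ₂.le (Real.rpow_nonneg ht0.le _), ← Real.rpow_mul ht0.le] at h1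
  have h2 : t₀ ^ (65 / 697 : ℝ) ≤ t ^ (65 / 697 : ℝ) := Real.rpow_le_rpow ht₀.le ht (by norm_num)
  have h3 : t ^ ((7 / 17 : ℝ) * (36 / 41)) * t ^ (-(11 / 41 : ℝ)) = t ^ (65 / 697 : ℝ) := by
    rw [← Real.rpow_add ht0]; norm_num
  calc θ₁ * θ₂ ^ (36 / 41 : ℝ) * t₀ ^ (65 / 697 : ℝ)
      ≤ θ₁ * θ₂ ^ (36 / 41 : ℝ) * t ^ (65 / 697 : ℝ) := by gcongr
    _ = θ₁ * (θ₂ ^ (36 / 41 : ℝ) * t ^ ((7 / 17 : ℝ) * (36 / 41))) * t ^ (-(11 / 41 : ℝ)) := by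
        rw [← h3]; ring
    _ ≤ θ₁ * a ^ (36 / 41 : ℝ) * t ^ (-(11 / 41 : ℝ)) := by gcongr

/-- **`Q/a ≤ ε₁`**: for `a ≥ θ₂t^{7/17}`, `t ≥ t₀`, `Q/a ≤ θ₁θ₂^{-5/41}t₀^{-222/697}`.
[cite: PatelYang2024, Lemma 3.4] -/
theorem pyQ_div_le {θ₁ θ₂ a t t₀ : ℝ} (hθ₁ : 0 < θ₁) (hθ₂ : 0 < θ₂) (ht₀ : 0 < t₀) (ht : t₀ ≤ t)
    (ha : θ₂ * t ^ (7 / 17 : ℝ) ≤ a) :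
    pyQ θ₁ a t / a ≤ θ₁ * θ₂ ^ (-(5 / 41 : ℝ)) * t₀ ^ (-(222 / 697 : ℝ)) := by
  have ht0 : 0 < t := ht₀.trans_le ht
  have hb0 : 0 < θ₂ * t ^ (7 / 17 : ℝ) := by positivity
  have ha0 : 0 < a := lt_of_lt_of_le hb0 ha
  unfold pyQ
  have e1 : θ₁ * a ^ (36 / 41 : ℝ) * t ^ (-(11 / 41 : ℝ)) / a = θ₁ * a ^ (-(5 / 41 : ℝ)) * t ^ (-(11 / 41 : ℝ)) := by
    rw [show (-(5 / 41 : ℝ)) = 36 / 41 - 1 by norm_num, Real.rpow_sub_one ha0.ne']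
    ring
  rw [e1]
  have h1 : a ^ (-(5 / 41 : ℝ)) ≤ (θ₂ * t ^ (7 / 17 : ℝ)) ^ (-(5 / 41 : ℝ)) :=
    Real.rpow_le_rpow_of_nonpos hb0 ha (by norm_num)
  rw [Real.mul_rpow hθ₂.le (Real.rpow_nonneg ht0.le _), ← Real.rpow_mul ht0.le] at h1
  have h2 : t ^ (-(222 / 697 : ℝ)) ≤ t₀ ^ (-(222 / 697 : ℝ)) :=
    Real.rpow_le_rpow_of_nonpos ht₀ ht (by norm_num)
  have h3 : t ^ ((7 / 17 : ℝ) * -(5 / 41)) * t ^ (-(11 / 41 : ℝ)) = t ^ (-(222 / 697 : ℝ)) := by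
    rw [← Real.rpow_add ht0]; norm_num
  calc θ₁ * a ^ (-(5 / 41 : ℝ)) * t ^ (-(11 / 41 : ℝ))
      ≤ θ₁ * (θ₂ ^ (-(5 / 41 : ℝ)) * t ^ ((7 / 17 : ℝ) * -(5 / 41))) * t ^ (-(11 / 41 : ℝ)) := by gcongr
    _ = θ₁ * θ₂ ^ (-(5 / 41 : ℝ)) * t ^ (-(222 / 697 : ℝ)) := by rw [← h3]; ring
    _ ≤ θ₁ * θ₂ ^ (-(5 / 41 : ℝ)) * t₀ ^ (-(222 / 697 : ℝ)) := by gcongr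

/-! ### `(2/q)·T` in closed form and its monomial bound -/

/-- `(2/q) T(t,h,η,a,q)` in closed form (`q > 0`). [cite: PatelYang2024, Lemma 3.4] -/
theorem two_div_mul_topBlockT_eq {t h η a q : ℝ} (hq : 0 < q) :
    2 / q * topBlockT t h η a q
      = 8 / 3 * ((3 + 50 * h ^ 8) / Real.sqrt 2 * (h * Real.sqrt h))
          * a ^ (3 / 2 : ℝ) * (t / (2 * π)) ^ (-(1 / 2 : ℝ)) * q ^ (-(1 / 2 : ℝ))
        + 1800 / 2911 * (3 / Real.sqrt 2 * (h * Real.sqrt h) * yangA η (h ^ 13) 5 * (h ^ 13) ^ (1 / 8 : ℝ)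
            * (2 * (h - 1)) * (105 / 16 / h ^ 2) ^ (1 / 30 : ℝ))
          * a ^ (-(1 / 5 : ℝ)) * (t / (2 * π)) ^ (11 / 30 : ℝ) * q ^ (11 / 30 : ℝ)
        + 28800 / 54481 * (3 / Real.sqrt 2 * (h * Real.sqrt h) * yangB η 5 * (2 * (h - 1)) ^ (7 / 8 : ℝ)
            * ((105 / 16 / h ^ 2) ^ (1 / 30 : ℝ))⁻¹)
          * a ^ (-(11 / 20 : ℝ)) * (t / (2 * π)) ^ (61 / 120 : ℝ) * q ^ (61 / 120 : ℝ)
        + 2 * (50 * h ^ 8 * (Real.log 2 + 3))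
        + 9 / 14 * (50 * h ^ 8 * 3 * ((h - 1) / h ^ 3) ^ (1 / 3 : ℝ))
          * a ^ (-(2 / 3 : ℝ)) * (t / (2 * π)) ^ (1 / 3 : ℝ) * q ^ (1 / 3 : ℝ)
        + 25 / 42 * (50 * h ^ 8 * (h - 1) * (12 / h ^ 7) ^ (1 / 5 : ℝ))
          * a ^ (-(2 / 5 : ℝ)) * (t / (2 * π)) ^ (2 / 5 : ℝ) * q ^ (2 / 5 : ℝ) := by
  unfold topBlockT
  have h12 : q ^ (1 - 1 / 2 : ℝ) = q ^ (-(1 / 2 : ℝ)) * q := by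
    have := Real.rpow_add hq (-(1 / 2)) 1
    rw [Real.rpow_one] at this
    norm_num at this ⊢
    exact this
  have hA : q ^ (1 + 11 / 30 : ℝ) = q * q ^ (11 / 30 : ℝ) := by
    rw [Real.rpow_add hq, Real.rpow_one]
  have hB : q ^ (1 + 61 / 120 : ℝ) = q * q ^ (61 / 120 : ℝ) := by
    rw [Real.rpow_add hq, Real.rpow_one]
  have hC : q ^ (1 + 1 / 3 : ℝ) = q * q ^ (1 / 3 : ℝ) := by
    rw [Real.rpow_add hq, Real.rpow_one]
  have hD : q ^ (1 + 2 / 5 : ℝ) = q * q ^ (2 / 5 : ℝ) := by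
    rw [Real.rpow_add hq, Real.rpow_one]
  rw [h12, hA, hB, hC, hD]
  field_simp
  ring

/-- `(t/2π)^r = (2π)^{-r} t^r`. [folklore] -/
theorem K_rpow_eq {t : ℝ} (ht : 0 < t) (r : ℝ) :
    (t / (2 * π)) ^ r = (2 * π) ^ (-r) * t ^ r := by
  rw [Real.div_rpow ht.le (by positivity), Real.rpow_neg (by positivity)]; ring

/-- Powers of `q ∈ [Q, (1+q₀⁻¹)Q]`, `Q = θ₁a^{36/41}t^{-11/41}`: `q^s ≤ ((1+q₀⁻¹)θ₁)^s a^{36s/41} t^{-11s/41}`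
for `s ≥ 0`. [cite: PatelYang2024, Lemma 3.4] -/
theorem pyq_rpow_le {θ₁ a t q₀ q s : ℝ} (hθ₁ : 0 < θ₁) (ha : 0 < a) (ht : 0 < t) (hq₀ : 0 < q₀)
    (hqQ : q ≤ (1 + q₀⁻¹) * pyQ θ₁ a t) (hq : 0 ≤ q) (hs : 0 ≤ s) :
    q ^ s ≤ ((1 + q₀⁻¹) * θ₁) ^ s * a ^ (36 / 41 * s) * t ^ (-(11 / 41) * s) := by
  have h1 : q ^ s ≤ ((1 + q₀⁻¹) * pyQ θ₁ a t) ^ s := Real.rpow_le_rpow hq hqQ hs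
  refine h1.trans (le_of_eq ?_)
  unfold pyQ
  rw [show (1 + q₀⁻¹) * (θ₁ * a ^ (36 / 41 : ℝ) * t ^ (-(11 / 41 : ℝ)))
      = ((1 + q₀⁻¹) * θ₁) * a ^ (36 / 41 : ℝ) * t ^ (-(11 / 41 : ℝ)) by ring,
    triple_rpow (by positivity) ha ht]

/-- `q^{-1/2} ≤ Q^{-1/2} = θ₁^{-1/2} a^{-18/41} t^{11/82}` for `q ≥ Q`. [cite: PatelYang2024, Lemma 3.4] -/
theorem pyq_rpow_neg_half_le {θ₁ a t q : ℝ} (hθ₁ : 0 < θ₁) (ha : 0 < a) (ht : 0 < t)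
    (hQq : pyQ θ₁ a t ≤ q) :
    q ^ (-(1 / 2 : ℝ)) ≤ θ₁ ^ (-(1 / 2 : ℝ)) * a ^ (-(18 / 41 : ℝ)) * t ^ (11 / 82 : ℝ) := by
  have hQ0 : 0 < pyQ θ₁ a t := by unfold pyQ; positivity
  have h1 : q ^ (-(1 / 2 : ℝ)) ≤ (pyQ θ₁ a t) ^ (-(1 / 2 : ℝ)) :=
    Real.rpow_le_rpow_of_nonpos hQ0 hQq (by norm_num)
  refine h1.trans (le_of_eq ?_)
  unfold pyQ
  rw [triple_rpow hθ₁.le ha ht]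
  norm_num

/-- `(h-1)a/q ≤ (h-1)θ₁⁻¹ a^{5/41} t^{11/41}` for `q ≥ Q`. [cite: PatelYang2024, Lemma 3.4] -/
theorem hN_div_pyq_le {θ₁ a t h q : ℝ} (hθ₁ : 0 < θ₁) (ha : 0 < a) (ht : 0 < t) (hh : 1 ≤ h)
    (hQq : pyQ θ₁ a t ≤ q) :
    (h - 1) * a / q ≤ (h - 1) * θ₁⁻¹ * a ^ (5 / 41 : ℝ) * t ^ (11 / 41 : ℝ) := by
  have hQ0 : 0 < pyQ θ₁ a t := by unfold pyQ; positivity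
  have hq0 : 0 < q := hQ0.trans_le hQq
  calc (h - 1) * a / q ≤ (h - 1) * a / pyQ θ₁ a t :=
        div_le_div_of_nonneg_left (by nlinarith) hQ0 hQq
    _ = (h - 1) * θ₁⁻¹ * a ^ (5 / 41 : ℝ) * t ^ (11 / 41 : ℝ) := by
        unfold pyQ
        have e1 : a = a ^ (5 / 41 : ℝ) * a ^ (36 / 41 : ℝ) := by
          rw [← Real.rpow_add ha]; norm_num
        have e2 : t ^ (11 / 41 : ℝ) * t ^ (-(11 / 41 : ℝ)) = 1 := by
          rw [← Real.rpow_add ht]; norm_num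
        have hane : a ^ (36 / 41 : ℝ) ≠ 0 := (Real.rpow_pos_of_pos ha _).ne'
        have htne : t ^ (-(11 / 41 : ℝ)) ≠ 0 := (Real.rpow_pos_of_pos ht _).ne'
        have hD : θ₁ * a ^ (36 / 41 : ℝ) * t ^ (-(11 / 41 : ℝ)) ≠ 0 := by positivity
        rw [div_eq_iff hD]
        conv_lhs => rw [e1]
        calc (h - 1) * (a ^ (5 / 41 : ℝ) * a ^ (36 / 41 : ℝ))
            = (h - 1) * (a ^ (5 / 41 : ℝ) * a ^ (36 / 41 : ℝ)) * (t ^ (11 / 41 : ℝ) * t ^ (-(11 / 41 : ℝ))) := by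
              rw [e2, mul_one]
          _ = (h - 1) * θ₁⁻¹ * a ^ (5 / 41 : ℝ) * t ^ (11 / 41 : ℝ)
              * (θ₁ * a ^ (36 / 41 : ℝ) * t ^ (-(11 / 41 : ℝ))) := by
              field_simp


/-! ### The monomial block bound -/

set_option maxHeartbeats 1600000 in
/-- **Patel–Yang's Lemma 3.4 with `q = ⌊θ₁a^{36/41}t^{-11/41}⌋ + 1`** (our constants): for
`0 < t₀ ≤ t`, `1 < h`, `η, θ₁, θ₂ > 0`, naturals `a ≥ max(1, θ₂t^{7/17})` and `b ≤ ha`,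
`‖∑_{a<n≤b} n^{-(1/2+it)}‖ ≤ √(h-1+ε₁)·(√κ₁ a^{5/82}t^{11/82} + √κ₂ a^{-17/328}t^{61/328}
  + √κ₀ a^{87/164}t^{-15/82} + √κ₃ + √κ₄ a^{-23/123}t^{5/41} + √κ₅ a^{-1/41}t^{6/41})`
with `ε₁ = θ₁θ₂^{-5/41}t₀^{-222/697}`, `ω = (1 + q₀⁻¹)θ₁`, `q₀ = θ₁θ₂^{36/41}t₀^{65/697}` and the
displayed `κ_i`. [cite: PatelYang2024, Lemma 3.4] -/
theorem topBlock_phi_le {t t₀ h η θ₁ θ₂ : ℝ} (ht₀ : 0 < t₀) (ht : t₀ ≤ t) (hh1 : 1 < h) (hη : 0 < η)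
    (hθ₁ : 0 < θ₁) (hθ₂ : 0 < θ₂) {a b : ℕ} (ha : 1 ≤ a) (haθ : θ₂ * t ^ (7 / 17 : ℝ) ≤ a)
    (hb : (b : ℝ) ≤ h * a) :
    ‖∑ n ∈ Finset.Ioc a b, (n : ℂ) ^ (-((1 / 2 : ℂ) + t * Complex.I))‖
      ≤ Real.sqrt (h - 1 + θ₁ * θ₂ ^ (-(5 / 41 : ℝ)) * t₀ ^ (-(222 / 697 : ℝ))) *
        (Real.sqrt ((h - 1) * θ₁⁻¹ + 1800 / 2911 * (3 / Real.sqrt 2 * (h * Real.sqrt h)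
              * yangA η (h ^ 13) 5 * (h ^ 13) ^ (1 / 8 : ℝ) * (2 * (h - 1)) * (105 / 16 / h ^ 2) ^ (1 / 30 : ℝ))
              * (2 * π) ^ (-(11 / 30 : ℝ))
              * ((1 + (θ₁ * θ₂ ^ (36 / 41 : ℝ) * t₀ ^ (65 / 697 : ℝ))⁻¹) * θ₁) ^ (11 / 30 : ℝ))
            * (a : ℝ) ^ (5 / 82 : ℝ) * t ^ (11 / 82 : ℝ)
        + Real.sqrt (28800 / 54481 * (3 / Real.sqrt 2 * (h * Real.sqrt h) * yangB η 5
              * (2 * (h - 1)) ^ (7 / 8 : ℝ) * ((105 / 16 / h ^ 2) ^ (1 / 30 : ℝ))⁻¹)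
              * (2 * π) ^ (-(61 / 120 : ℝ))
              * ((1 + (θ₁ * θ₂ ^ (36 / 41 : ℝ) * t₀ ^ (65 / 697 : ℝ))⁻¹) * θ₁) ^ (61 / 120 : ℝ))
            * (a : ℝ) ^ (-(17 / 328 : ℝ)) * t ^ (61 / 328 : ℝ)
        + Real.sqrt (8 / 3 * ((3 + 50 * h ^ 8) / Real.sqrt 2 * (h * Real.sqrt h))
              * (2 * π) ^ (1 / 2 : ℝ) * θ₁ ^ (-(1 / 2 : ℝ)))
            * (a : ℝ) ^ (87 / 164 : ℝ) * t ^ (-(15 / 82 : ℝ))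
        + Real.sqrt (2 * (50 * h ^ 8 * (Real.log 2 + 3)))
        + Real.sqrt (9 / 14 * (50 * h ^ 8 * 3 * ((h - 1) / h ^ 3) ^ (1 / 3 : ℝ))
              * (2 * π) ^ (-(1 / 3 : ℝ))
              * ((1 + (θ₁ * θ₂ ^ (36 / 41 : ℝ) * t₀ ^ (65 / 697 : ℝ))⁻¹) * θ₁) ^ (1 / 3 : ℝ))
            * (a : ℝ) ^ (-(23 / 123 : ℝ)) * t ^ (5 / 41 : ℝ)
        + Real.sqrt (25 / 42 * (50 * h ^ 8 * (h - 1) * (12 / h ^ 7) ^ (1 / 5 : ℝ))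
              * (2 * π) ^ (-(2 / 5 : ℝ))
              * ((1 + (θ₁ * θ₂ ^ (36 / 41 : ℝ) * t₀ ^ (65 / 697 : ℝ))⁻¹) * θ₁) ^ (2 / 5 : ℝ))
            * (a : ℝ) ^ (-(1 / 41 : ℝ)) * t ^ (6 / 41 : ℝ)) := by
  have hπ := Real.pi_pos
  have ht0 : 0 < t := ht₀.trans_le ht
  have hh : 1 ≤ h := hh1.le
  have hh0 : 0 < h := by linarith
  have hh1' : 0 ≤ h - 1 := by linarith
  have ha0 : (0 : ℝ) < a := by exact_mod_cast (show 0 < a by omega)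
  have hA5 : 0 < yangA η (h ^ 13) 5 := yangA_pos hη (one_le_pow₀ hh) 5 (by norm_num)
  have hB5 : 0 < yangB η 5 := yangB_pos hη 5 (by norm_num)
  have hlog2 : 0 < Real.log 2 := Real.log_pos (by norm_num)
  have hW0 : 0 ≤ (h - 1) / h ^ 3 := by positivity
  -- the constants
  set c₀ : ℝ := (3 + 50 * h ^ 8) / Real.sqrt 2 * (h * Real.sqrt h) with hc₀
  set c₁ : ℝ := 3 / Real.sqrt 2 * (h * Real.sqrt h) * yangA η (h ^ 13) 5 * (h ^ 13) ^ (1 / 8 : ℝ)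
    * (2 * (h - 1)) * (105 / 16 / h ^ 2) ^ (1 / 30 : ℝ) with hc₁
  set c₂ : ℝ := 3 / Real.sqrt 2 * (h * Real.sqrt h) * yangB η 5 * (2 * (h - 1)) ^ (7 / 8 : ℝ)
    * ((105 / 16 / h ^ 2) ^ (1 / 30 : ℝ))⁻¹ with hc₂
  set e₀ : ℝ := 50 * h ^ 8 * (Real.log 2 + 3) with he₀
  set e₁ : ℝ := 50 * h ^ 8 * 3 * ((h - 1) / h ^ 3) ^ (1 / 3 : ℝ) with he₁
  set e₂ : ℝ := 50 * h ^ 8 * (h - 1) * (12 / h ^ 7) ^ (1 / 5 : ℝ) with he₂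
  have hc₀0 : 0 ≤ c₀ := by positivity
  have hc₁0 : 0 ≤ c₁ := by positivity
  have hc₂0 : 0 ≤ c₂ := by positivity
  have he₀0 : 0 ≤ e₀ := by positivity
  have he₁0 : 0 ≤ e₁ := by positivity
  have he₂0 : 0 ≤ e₂ := by positivity
  clear_value c₀ c₁ c₂ e₀ e₁ e₂
  set q₀ : ℝ := θ₁ * θ₂ ^ (36 / 41 : ℝ) * t₀ ^ (65 / 697 : ℝ) with hq₀
  set ε₁ : ℝ := θ₁ * θ₂ ^ (-(5 / 41 : ℝ)) * t₀ ^ (-(222 / 697 : ℝ)) with hε₁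
  set ω : ℝ := (1 + q₀⁻¹) * θ₁ with hω
  have hq₀0 : 0 < q₀ := by positivity
  have hε₁0 : 0 < ε₁ := by positivity
  have hω0 : 0 < ω := by positivity
  clear_value q₀ ε₁ ω
  -- the shift parameter
  set Q : ℝ := pyQ θ₁ a t with hQdef
  have hQ0 : 0 < Q := by rw [hQdef]; unfold pyQ; positivity
  have hQq : Q ≤ (pyq θ₁ a t : ℝ) := pyQ_le_pyq θ₁ a t
  have hq1 : 1 ≤ pyq θ₁ a t := one_le_pyq θ₁ a t
  have hqpos : (0 : ℝ) < pyq θ₁ a t := by exact_mod_cast hq1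
  have hq₀Q : q₀ ≤ Q := by rw [hq₀, hQdef]; exact pyQ_ge hθ₁ hθ₂ ht₀ ht haθ
  have hqQ : (pyq θ₁ a t : ℝ) ≤ (1 + q₀⁻¹) * Q := by
    have h1 := pyq_le θ₁ a t hQ0.le
    have h2 : 1 ≤ q₀⁻¹ * Q := by
      rw [inv_mul_eq_div, one_le_div hq₀0]; exact hq₀Q
    rw [← hQdef] at h1
    nlinarith
  have hQa : Q / a ≤ ε₁ := by rw [hQdef, hε₁]; exact pyQ_div_le hθ₁ hθ₂ ht₀ ht haθ
  have hq_le1 : (pyq θ₁ a t : ℝ) ≤ Q + 1 := by rw [hQdef]; exact pyq_le θ₁ a t (by rw [← hQdef]; exact hQ0.le)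
  have hqn := pyq_rpow_neg_half_le hθ₁ ha0 ht0 (hQdef ▸ hQq)
  have hq11 := pyq_rpow_le (s := 11 / 30) hθ₁ ha0 ht0 hq₀0 (hQdef ▸ hqQ) hqpos.le (by norm_num)
  have hq61 := pyq_rpow_le (s := 61 / 120) hθ₁ ha0 ht0 hq₀0 (hQdef ▸ hqQ) hqpos.le (by norm_num)
  have hq13 := pyq_rpow_le (s := 1 / 3) hθ₁ ha0 ht0 hq₀0 (hQdef ▸ hqQ) hqpos.le (by norm_num)
  have hq25 := pyq_rpow_le (s := 2 / 5) hθ₁ ha0 ht0 hq₀0 (hQdef ▸ hqQ) hqpos.le (by norm_num)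
  rw [← hω] at hq11 hq61 hq13 hq25
  clear_value Q
  -- the block bound with free `q`
  have hS := topBlock_cpow_le (η := η) ht0 hh1 hη ha hb hq1
  refine hS.trans ?_
  -- `F ≤ (h-1+ε₁) a`
  have hF : (h - 1) * a - 1 + (pyq θ₁ a t : ℝ) ≤ (h - 1 + ε₁) * a := by
    have h2 := hQa
    rw [div_le_iff₀ ha0] at h2
    nlinarith
  have hF0 : 0 ≤ (h - 1) * a - 1 + (pyq θ₁ a t : ℝ) := by
    have : (1 : ℝ) ≤ pyq θ₁ a t := by exact_mod_cast hq1
    nlinarith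
  -- `G ≤ Σ Mᵢ`
  have hT := two_div_mul_topBlockT_eq (t := t) (h := h) (η := η) (a := (a : ℝ)) hqpos
  rw [← hc₀, ← hc₁, ← hc₂, ← he₁, ← he₂] at hT
  have hK1 := K_rpow_eq ht0 (-(1 / 2 : ℝ))
  have hK2 := K_rpow_eq ht0 (11 / 30 : ℝ)
  have hK3 := K_rpow_eq ht0 (61 / 120 : ℝ)
  have hK4 := K_rpow_eq ht0 (1 / 3 : ℝ)
  have hK5 := K_rpow_eq ht0 (2 / 5 : ℝ)
  -- the monomial targets
  have m0 : (a : ℝ) ^ (3 / 2 : ℝ) * t ^ (-(1 / 2 : ℝ)) * ((a : ℝ) ^ (-(18 / 41 : ℝ)) * t ^ (11 / 82 : ℝ))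
      = (a : ℝ) ^ (87 / 82 : ℝ) * t ^ (-(15 / 41 : ℝ)) :=
    monomial_mul ha0 ht0 (by norm_num) (by norm_num)
  have m1 : (a : ℝ) ^ (-(1 / 5 : ℝ)) * t ^ (11 / 30 : ℝ)
        * ((a : ℝ) ^ (36 / 41 * (11 / 30) : ℝ) * t ^ (-(11 / 41) * (11 / 30) : ℝ))
      = (a : ℝ) ^ (5 / 41 : ℝ) * t ^ (11 / 41 : ℝ) :=
    monomial_mul ha0 ht0 (by norm_num) (by norm_num)
  have m2 : (a : ℝ) ^ (-(11 / 20 : ℝ)) * t ^ (61 / 120 : ℝ)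
        * ((a : ℝ) ^ (36 / 41 * (61 / 120) : ℝ) * t ^ (-(11 / 41) * (61 / 120) : ℝ))
      = (a : ℝ) ^ (-(17 / 164 : ℝ)) * t ^ (61 / 164 : ℝ) :=
    monomial_mul ha0 ht0 (by norm_num) (by norm_num)
  have m4 : (a : ℝ) ^ (-(2 / 3 : ℝ)) * t ^ (1 / 3 : ℝ)
        * ((a : ℝ) ^ (36 / 41 * (1 / 3) : ℝ) * t ^ (-(11 / 41) * (1 / 3) : ℝ))
      = (a : ℝ) ^ (-(46 / 123 : ℝ)) * t ^ (10 / 41 : ℝ) :=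
    monomial_mul ha0 ht0 (by norm_num) (by norm_num)
  have m5 : (a : ℝ) ^ (-(2 / 5 : ℝ)) * t ^ (2 / 5 : ℝ)
        * ((a : ℝ) ^ (36 / 41 * (2 / 5) : ℝ) * t ^ (-(11 / 41) * (2 / 5) : ℝ))
      = (a : ℝ) ^ (-(2 / 41 : ℝ)) * t ^ (12 / 41 : ℝ) :=
    monomial_mul ha0 ht0 (by norm_num) (by norm_num)
  -- κ's
  set κ₁ : ℝ := (h - 1) * θ₁⁻¹ + 1800 / 2911 * c₁ * (2 * π) ^ (-(11 / 30 : ℝ)) * ω ^ (11 / 30 : ℝ) with hκ₁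
  set κ₂ : ℝ := 28800 / 54481 * c₂ * (2 * π) ^ (-(61 / 120 : ℝ)) * ω ^ (61 / 120 : ℝ) with hκ₂
  set κ₀ : ℝ := 8 / 3 * c₀ * (2 * π) ^ (1 / 2 : ℝ) * θ₁ ^ (-(1 / 2 : ℝ)) with hκ₀
  set κ₃ : ℝ := 2 * e₀ with hκ₃
  set κ₄ : ℝ := 9 / 14 * e₁ * (2 * π) ^ (-(1 / 3 : ℝ)) * ω ^ (1 / 3 : ℝ) with hκ₄
  set κ₅ : ℝ := 25 / 42 * e₂ * (2 * π) ^ (-(2 / 5 : ℝ)) * ω ^ (2 / 5 : ℝ) with hκ₅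
  have hκ₁0 : 0 ≤ κ₁ := by positivity
  have hκ₂0 : 0 ≤ κ₂ := by positivity
  have hκ₀0 : 0 ≤ κ₀ := by positivity
  have hκ₃0 : 0 ≤ κ₃ := by positivity
  have hκ₄0 : 0 ≤ κ₄ := by positivity
  have hκ₅0 : 0 ≤ κ₅ := by positivity
  clear_value κ₁ κ₂ κ₀ κ₃ κ₄ κ₅
  have hG : (h - 1) * a / (pyq θ₁ a t : ℝ) + 2 / (pyq θ₁ a t : ℝ) * topBlockT t h η a (pyq θ₁ a t)
      ≤ κ₁ * ((a : ℝ) ^ (5 / 41 : ℝ) * t ^ (11 / 41 : ℝ))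
        + κ₂ * ((a : ℝ) ^ (-(17 / 164 : ℝ)) * t ^ (61 / 164 : ℝ))
        + κ₀ * ((a : ℝ) ^ (87 / 82 : ℝ) * t ^ (-(15 / 41 : ℝ)))
        + κ₃
        + κ₄ * ((a : ℝ) ^ (-(46 / 123 : ℝ)) * t ^ (10 / 41 : ℝ))
        + κ₅ * ((a : ℝ) ^ (-(2 / 41 : ℝ)) * t ^ (12 / 41 : ℝ)) := by
    have hN := hN_div_pyq_le (h := h) hθ₁ ha0 ht0 hh (hQdef ▸ hQq)
    rw [hT, hK1, hK2, hK3, hK4, hK5]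
    -- term 0
    have t0 : 8 / 3 * c₀ * (a : ℝ) ^ (3 / 2 : ℝ) * ((2 * π) ^ (-(-(1 / 2 : ℝ))) * t ^ (-(1 / 2 : ℝ)))
          * (pyq θ₁ a t : ℝ) ^ (-(1 / 2 : ℝ))
        ≤ κ₀ * ((a : ℝ) ^ (87 / 82 : ℝ) * t ^ (-(15 / 41 : ℝ))) := by
      have hX : 0 ≤ 8 / 3 * c₀ * (a : ℝ) ^ (3 / 2 : ℝ) * ((2 * π) ^ (-(-(1 / 2 : ℝ))) * t ^ (-(1 / 2 : ℝ))) := by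
        positivity
      refine (mul_le_mul_of_nonneg_left hqn hX).trans (le_of_eq ?_)
      rw [hκ₀, ← m0, neg_neg]; ring
    -- term 1
    have t1 : 1800 / 2911 * c₁ * (a : ℝ) ^ (-(1 / 5 : ℝ)) * ((2 * π) ^ (-(11 / 30 : ℝ)) * t ^ (11 / 30 : ℝ))
          * (pyq θ₁ a t : ℝ) ^ (11 / 30 : ℝ)
        ≤ (1800 / 2911 * c₁ * (2 * π) ^ (-(11 / 30 : ℝ)) * ω ^ (11 / 30 : ℝ))
          * ((a : ℝ) ^ (5 / 41 : ℝ) * t ^ (11 / 41 : ℝ)) := by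
      have hX : 0 ≤ 1800 / 2911 * c₁ * (a : ℝ) ^ (-(1 / 5 : ℝ)) * ((2 * π) ^ (-(11 / 30 : ℝ)) * t ^ (11 / 30 : ℝ)) := by
        positivity
      refine (mul_le_mul_of_nonneg_left hq11 hX).trans (le_of_eq ?_)
      rw [← m1]; ring
    -- term 2
    have t2 : 28800 / 54481 * c₂ * (a : ℝ) ^ (-(11 / 20 : ℝ)) * ((2 * π) ^ (-(61 / 120 : ℝ)) * t ^ (61 / 120 : ℝ))
          * (pyq θ₁ a t : ℝ) ^ (61 / 120 : ℝ)
        ≤ κ₂ * ((a : ℝ) ^ (-(17 / 164 : ℝ)) * t ^ (61 / 164 : ℝ)) := by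
      have hX : 0 ≤ 28800 / 54481 * c₂ * (a : ℝ) ^ (-(11 / 20 : ℝ)) * ((2 * π) ^ (-(61 / 120 : ℝ)) * t ^ (61 / 120 : ℝ)) := by
        positivity
      refine (mul_le_mul_of_nonneg_left hq61 hX).trans (le_of_eq ?_)
      rw [hκ₂, ← m2]; ring
    -- term 4
    have t4 : 9 / 14 * e₁ * (a : ℝ) ^ (-(2 / 3 : ℝ)) * ((2 * π) ^ (-(1 / 3 : ℝ)) * t ^ (1 / 3 : ℝ))
          * (pyq θ₁ a t : ℝ) ^ (1 / 3 : ℝ)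
        ≤ κ₄ * ((a : ℝ) ^ (-(46 / 123 : ℝ)) * t ^ (10 / 41 : ℝ)) := by
      have hX : 0 ≤ 9 / 14 * e₁ * (a : ℝ) ^ (-(2 / 3 : ℝ)) * ((2 * π) ^ (-(1 / 3 : ℝ)) * t ^ (1 / 3 : ℝ)) := by
        positivity
      refine (mul_le_mul_of_nonneg_left hq13 hX).trans (le_of_eq ?_)
      rw [hκ₄, ← m4]; ring
    -- term 5
    have t5 : 25 / 42 * e₂ * (a : ℝ) ^ (-(2 / 5 : ℝ)) * ((2 * π) ^ (-(2 / 5 : ℝ)) * t ^ (2 / 5 : ℝ))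
          * (pyq θ₁ a t : ℝ) ^ (2 / 5 : ℝ)
        ≤ κ₅ * ((a : ℝ) ^ (-(2 / 41 : ℝ)) * t ^ (12 / 41 : ℝ)) := by
      have hX : 0 ≤ 25 / 42 * e₂ * (a : ℝ) ^ (-(2 / 5 : ℝ)) * ((2 * π) ^ (-(2 / 5 : ℝ)) * t ^ (2 / 5 : ℝ)) := by
        positivity
      refine (mul_le_mul_of_nonneg_left hq25 hX).trans (le_of_eq ?_)
      rw [hκ₅, ← m5]; ring
    have hNk : (h - 1) * θ₁⁻¹ * (a : ℝ) ^ (5 / 41 : ℝ) * t ^ (11 / 41 : ℝ)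
        + (1800 / 2911 * c₁ * (2 * π) ^ (-(11 / 30 : ℝ)) * ω ^ (11 / 30 : ℝ))
          * ((a : ℝ) ^ (5 / 41 : ℝ) * t ^ (11 / 41 : ℝ))
        = κ₁ * ((a : ℝ) ^ (5 / 41 : ℝ) * t ^ (11 / 41 : ℝ)) := by rw [hκ₁]; ring
    have hk3 : 2 * e₀ = κ₃ := by rw [hκ₃]
    rw [he₀] at hk3
    linarith [hN, t0, t1, t2, t4, t5, hNk, hk3]
  -- `√(F G) ≤ √(h-1+ε₁) √a Σ √Mᵢ`
  have hG0 : 0 ≤ (h - 1) * a / (pyq θ₁ a t : ℝ) + 2 / (pyq θ₁ a t : ℝ) * topBlockT t h η a (pyq θ₁ a t) := by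
    have := topBlockT_nonneg (q := (pyq θ₁ a t : ℝ)) ht0 hh1 hη ha0 hqpos.le
    positivity
  have hM0 : ∀ x y : ℝ, 0 ≤ (a : ℝ) ^ x * t ^ y := fun x y => by positivity
  have hFG : topBlockBound t h η a (pyq θ₁ a t)
      ≤ Real.sqrt (h - 1 + ε₁) * Real.sqrt a *
        (Real.sqrt (κ₁ * ((a : ℝ) ^ (5 / 41 : ℝ) * t ^ (11 / 41 : ℝ)))
          + Real.sqrt (κ₂ * ((a : ℝ) ^ (-(17 / 164 : ℝ)) * t ^ (61 / 164 : ℝ)))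
          + Real.sqrt (κ₀ * ((a : ℝ) ^ (87 / 82 : ℝ) * t ^ (-(15 / 41 : ℝ))))
          + Real.sqrt κ₃
          + Real.sqrt (κ₄ * ((a : ℝ) ^ (-(46 / 123 : ℝ)) * t ^ (10 / 41 : ℝ)))
          + Real.sqrt (κ₅ * ((a : ℝ) ^ (-(2 / 41 : ℝ)) * t ^ (12 / 41 : ℝ)))) := by
    unfold topBlockBound
    have h1 : ((h - 1) * a - 1 + (pyq θ₁ a t : ℝ))
          * ((h - 1) * a / (pyq θ₁ a t : ℝ) + 2 / (pyq θ₁ a t : ℝ) * topBlockT t h η a (pyq θ₁ a t))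
        ≤ ((h - 1 + ε₁) * a) * (κ₁ * ((a : ℝ) ^ (5 / 41 : ℝ) * t ^ (11 / 41 : ℝ))
          + κ₂ * ((a : ℝ) ^ (-(17 / 164 : ℝ)) * t ^ (61 / 164 : ℝ))
          + κ₀ * ((a : ℝ) ^ (87 / 82 : ℝ) * t ^ (-(15 / 41 : ℝ)))
          + κ₃
          + κ₄ * ((a : ℝ) ^ (-(46 / 123 : ℝ)) * t ^ (10 / 41 : ℝ))
          + κ₅ * ((a : ℝ) ^ (-(2 / 41 : ℝ)) * t ^ (12 / 41 : ℝ))) :=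
      mul_le_mul hF hG hG0 (by positivity)
    refine (Real.sqrt_le_sqrt h1).trans ?_
    rw [Real.sqrt_mul (by positivity), Real.sqrt_mul (by linarith)]
    refine mul_le_mul_of_nonneg_left ?_ (by positivity)
    have s1 := hM0 (5 / 41) (11 / 41)
    have s2 := hM0 (-(17 / 164)) (61 / 164)
    have s0 := hM0 (87 / 82) (-(15 / 41))
    have s4 := hM0 (-(46 / 123)) (10 / 41)
    have s5 := hM0 (-(2 / 41)) (12 / 41)
    have p1 : 0 ≤ κ₁ * ((a : ℝ) ^ (5 / 41 : ℝ) * t ^ (11 / 41 : ℝ)) := mul_nonneg hκ₁0 s1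
    have p2 : 0 ≤ κ₂ * ((a : ℝ) ^ (-(17 / 164 : ℝ)) * t ^ (61 / 164 : ℝ)) := mul_nonneg hκ₂0 s2
    have p0 : 0 ≤ κ₀ * ((a : ℝ) ^ (87 / 82 : ℝ) * t ^ (-(15 / 41 : ℝ))) := mul_nonneg hκ₀0 s0
    have p4 : 0 ≤ κ₄ * ((a : ℝ) ^ (-(46 / 123 : ℝ)) * t ^ (10 / 41 : ℝ)) := mul_nonneg hκ₄0 s4
    have p5 : 0 ≤ κ₅ * ((a : ℝ) ^ (-(2 / 41 : ℝ)) * t ^ (12 / 41 : ℝ)) := mul_nonneg hκ₅0 s5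
    calc Real.sqrt (κ₁ * ((a : ℝ) ^ (5 / 41 : ℝ) * t ^ (11 / 41 : ℝ))
            + κ₂ * ((a : ℝ) ^ (-(17 / 164 : ℝ)) * t ^ (61 / 164 : ℝ))
            + κ₀ * ((a : ℝ) ^ (87 / 82 : ℝ) * t ^ (-(15 / 41 : ℝ)))
            + κ₃
            + κ₄ * ((a : ℝ) ^ (-(46 / 123 : ℝ)) * t ^ (10 / 41 : ℝ))
            + κ₅ * ((a : ℝ) ^ (-(2 / 41 : ℝ)) * t ^ (12 / 41 : ℝ)))
        ≤ Real.sqrt (κ₁ * ((a : ℝ) ^ (5 / 41 : ℝ) * t ^ (11 / 41 : ℝ))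
            + κ₂ * ((a : ℝ) ^ (-(17 / 164 : ℝ)) * t ^ (61 / 164 : ℝ))
            + κ₀ * ((a : ℝ) ^ (87 / 82 : ℝ) * t ^ (-(15 / 41 : ℝ)))
            + κ₃
            + κ₄ * ((a : ℝ) ^ (-(46 / 123 : ℝ)) * t ^ (10 / 41 : ℝ)))
          + Real.sqrt (κ₅ * ((a : ℝ) ^ (-(2 / 41 : ℝ)) * t ^ (12 / 41 : ℝ))) :=
          sqrt_add_le' (by positivity) p5
      _ ≤ Real.sqrt (κ₁ * ((a : ℝ) ^ (5 / 41 : ℝ) * t ^ (11 / 41 : ℝ))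
            + κ₂ * ((a : ℝ) ^ (-(17 / 164 : ℝ)) * t ^ (61 / 164 : ℝ))
            + κ₀ * ((a : ℝ) ^ (87 / 82 : ℝ) * t ^ (-(15 / 41 : ℝ)))
            + κ₃)
          + Real.sqrt (κ₄ * ((a : ℝ) ^ (-(46 / 123 : ℝ)) * t ^ (10 / 41 : ℝ)))
          + Real.sqrt (κ₅ * ((a : ℝ) ^ (-(2 / 41 : ℝ)) * t ^ (12 / 41 : ℝ))) := by
          gcongr; exact sqrt_add_le' (by positivity) p4
      _ ≤ Real.sqrt (κ₁ * ((a : ℝ) ^ (5 / 41 : ℝ) * t ^ (11 / 41 : ℝ))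
            + κ₂ * ((a : ℝ) ^ (-(17 / 164 : ℝ)) * t ^ (61 / 164 : ℝ))
            + κ₀ * ((a : ℝ) ^ (87 / 82 : ℝ) * t ^ (-(15 / 41 : ℝ))))
          + Real.sqrt κ₃
          + Real.sqrt (κ₄ * ((a : ℝ) ^ (-(46 / 123 : ℝ)) * t ^ (10 / 41 : ℝ)))
          + Real.sqrt (κ₅ * ((a : ℝ) ^ (-(2 / 41 : ℝ)) * t ^ (12 / 41 : ℝ))) := by
          gcongr; exact sqrt_add_le' (by positivity) hκ₃0
      _ ≤ Real.sqrt (κ₁ * ((a : ℝ) ^ (5 / 41 : ℝ) * t ^ (11 / 41 : ℝ))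
            + κ₂ * ((a : ℝ) ^ (-(17 / 164 : ℝ)) * t ^ (61 / 164 : ℝ)))
          + Real.sqrt (κ₀ * ((a : ℝ) ^ (87 / 82 : ℝ) * t ^ (-(15 / 41 : ℝ))))
          + Real.sqrt κ₃
          + Real.sqrt (κ₄ * ((a : ℝ) ^ (-(46 / 123 : ℝ)) * t ^ (10 / 41 : ℝ)))
          + Real.sqrt (κ₅ * ((a : ℝ) ^ (-(2 / 41 : ℝ)) * t ^ (12 / 41 : ℝ))) := by
          gcongr; exact sqrt_add_le' (by positivity) p0
      _ ≤ _ := by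
          gcongr; exact sqrt_add_le' p1 p2
  -- `√(κ a^x t^y) = √κ a^{x/2} t^{y/2}` and `a^{-1/2} √a = 1`
  have r1 : Real.sqrt (κ₁ * ((a : ℝ) ^ (5 / 41 : ℝ) * t ^ (11 / 41 : ℝ)))
      = Real.sqrt κ₁ * (a : ℝ) ^ (5 / 82 : ℝ) * t ^ (11 / 82 : ℝ) := by
    rw [← mul_assoc, sqrt_monomial hκ₁0 ha0 ht0]; norm_num
  have r2 : Real.sqrt (κ₂ * ((a : ℝ) ^ (-(17 / 164 : ℝ)) * t ^ (61 / 164 : ℝ)))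
      = Real.sqrt κ₂ * (a : ℝ) ^ (-(17 / 328 : ℝ)) * t ^ (61 / 328 : ℝ) := by
    rw [← mul_assoc, sqrt_monomial hκ₂0 ha0 ht0]; norm_num
  have r0 : Real.sqrt (κ₀ * ((a : ℝ) ^ (87 / 82 : ℝ) * t ^ (-(15 / 41 : ℝ))))
      = Real.sqrt κ₀ * (a : ℝ) ^ (87 / 164 : ℝ) * t ^ (-(15 / 82 : ℝ)) := by
    rw [← mul_assoc, sqrt_monomial hκ₀0 ha0 ht0]; norm_num
  have r4 : Real.sqrt (κ₄ * ((a : ℝ) ^ (-(46 / 123 : ℝ)) * t ^ (10 / 41 : ℝ)))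
      = Real.sqrt κ₄ * (a : ℝ) ^ (-(23 / 123 : ℝ)) * t ^ (5 / 41 : ℝ) := by
    rw [← mul_assoc, sqrt_monomial hκ₄0 ha0 ht0]; norm_num
  have r5 : Real.sqrt (κ₅ * ((a : ℝ) ^ (-(2 / 41 : ℝ)) * t ^ (12 / 41 : ℝ)))
      = Real.sqrt κ₅ * (a : ℝ) ^ (-(1 / 41 : ℝ)) * t ^ (6 / 41 : ℝ) := by
    rw [← mul_assoc, sqrt_monomial hκ₅0 ha0 ht0]; norm_num
  have hhalf : (a : ℝ) ^ (-(1 / 2 : ℝ)) * Real.sqrt a = 1 := by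
    rw [Real.sqrt_eq_rpow, ← Real.rpow_add ha0]; norm_num
  rw [r1, r2, r0, r4, r5] at hFG
  calc (a : ℝ) ^ (-(1 / 2 : ℝ)) * topBlockBound t h η a (pyq θ₁ a t)
      ≤ (a : ℝ) ^ (-(1 / 2 : ℝ)) * (Real.sqrt (h - 1 + ε₁) * Real.sqrt a *
        (Real.sqrt κ₁ * (a : ℝ) ^ (5 / 82 : ℝ) * t ^ (11 / 82 : ℝ)
          + Real.sqrt κ₂ * (a : ℝ) ^ (-(17 / 328 : ℝ)) * t ^ (61 / 328 : ℝ)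
          + Real.sqrt κ₀ * (a : ℝ) ^ (87 / 164 : ℝ) * t ^ (-(15 / 82 : ℝ))
          + Real.sqrt κ₃
          + Real.sqrt κ₄ * (a : ℝ) ^ (-(23 / 123 : ℝ)) * t ^ (5 / 41 : ℝ)
          + Real.sqrt κ₅ * (a : ℝ) ^ (-(1 / 41 : ℝ)) * t ^ (6 / 41 : ℝ))) :=
        mul_le_mul_of_nonneg_left hFG (by positivity)
    _ = Real.sqrt (h - 1 + ε₁) *
        (Real.sqrt κ₁ * (a : ℝ) ^ (5 / 82 : ℝ) * t ^ (11 / 82 : ℝ)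
          + Real.sqrt κ₂ * (a : ℝ) ^ (-(17 / 328 : ℝ)) * t ^ (61 / 328 : ℝ)
          + Real.sqrt κ₀ * (a : ℝ) ^ (87 / 164 : ℝ) * t ^ (-(15 / 82 : ℝ))
          + Real.sqrt κ₃
          + Real.sqrt κ₄ * (a : ℝ) ^ (-(23 / 123 : ℝ)) * t ^ (5 / 41 : ℝ)
          + Real.sqrt κ₅ * (a : ℝ) ^ (-(1 / 41 : ℝ)) * t ^ (6 / 41 : ℝ)) := by
        calc _ = ((a : ℝ) ^ (-(1 / 2 : ℝ)) * Real.sqrt a) * (Real.sqrt (h - 1 + ε₁) *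
              (Real.sqrt κ₁ * (a : ℝ) ^ (5 / 82 : ℝ) * t ^ (11 / 82 : ℝ)
                + Real.sqrt κ₂ * (a : ℝ) ^ (-(17 / 328 : ℝ)) * t ^ (61 / 328 : ℝ)
                + Real.sqrt κ₀ * (a : ℝ) ^ (87 / 164 : ℝ) * t ^ (-(15 / 82 : ℝ))
                + Real.sqrt κ₃
                + Real.sqrt κ₄ * (a : ℝ) ^ (-(23 / 123 : ℝ)) * t ^ (5 / 41 : ℝ)
                + Real.sqrt κ₅ * (a : ℝ) ^ (-(1 / 41 : ℝ)) * t ^ (6 / 41 : ℝ))) := by ring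
          _ = _ := by rw [hhalf, one_mul]
    _ = _ := by rw [hκ₁, hκ₂, hκ₀, hκ₃, hκ₄, hκ₅]


end VdC
end Literature.NumberTheory.LFunctions
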